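import Summits.CriticalPhenomena.PercolationContinuityZ3.Theorems.PercNearOneGluingNoHeavyQuantFarLayerOnePendant
import Summits.CriticalPhenomena.PercolationContinuityZ3.Theorems.PercNearOneGluingNoHeavyQuantFarHairyCycleReach
import HarnessLib

/-!
# QUANT lane R8, front "FAR beyond trees" — PENDANT FORESTS ON A CYCLE (the presentation of a unicyclic support) — definitions and bookkeeping

builds on p205010 (kernel theorem, internal audit signed; external expert review pending)

Support file (`--supports stmt-CriticalPhenomena-4575`), seat `prim-quant-p1` (gen 18); memo
`run/shared/lean/prim/quant/prim-quant-p1-g18/FOR-LEAD-UNICYCLIC-TREES.md` §3, `FOR-PROVERS-FLATTENING-FC.md` §1.  One definition (`PForest`); standard axioms.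

`PForest L cyc idx T par dep w`: an injective cycle `c_i = cyc i` (`i < L`, `L ≥ 3`, `idx` an index map with `idx (c_i) = i`), a finset `T` of tree
vertices off the cycle with a parent map `par` (parent in `T` or on the cycle) and a ranking `dep` (`dep (par v) < dep v` when `par v ∈ T`), and `w`
supported on the cycle pairs `cycE` and the tree pairs `s(v, par v)`, `v ∈ T`.  Every finite weighted graph whose support is unicyclic, with the observer
`c_0` on the cycle and the relays in `T` or on the cycle, is of this form.  Bookkeeping: `par_ne`, `not_mem_cycE`, `pair_at`, `pendant_of_leaf`, and
`real_openConn_eq_zero_of_isolated` (a vertex with all pairs of weight `0` is joined to nothing).  The flattening induction is `…QuantFarLayerOneUnicyclic`.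
[cite: Grimmett1999, §1.3 p. 10] (product measure, open paths); [this work].
-/

noncomputable section

namespace Summit.CriticalPhenomena.PercolationContinuityZ3.Theorems

namespace Quant

namespace Bundle

open Finset MeasureTheory Set
open Literature.Probability.LatticeModels
open Literature.Probability.Percolation
open Summit.CriticalPhenomena.PercolationContinuityZ3.Theorems.HairyCycle (cycE)
open scoped Classical

variable {n : ℕ}

/-- **Pendant forest on a cycle** (presentation of a unicyclic support with the observer on the cycle). [this work] -/
structure PForest (L : ℕ) (cyc : ℕ → Fin n) (idx : Fin n → ℕ) (T : Finset (Fin n)) (par : Fin n → Fin n) (dep : Fin n → ℕ)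
    (w : Sym2 (Fin n) → unitInterval) : Prop where
  hL : 3 ≤ L
  hcyc : ∀ i j, i < L → j < L → cyc i = cyc j → i = j
  hidx : ∀ i, i < L → idx (cyc i) = i
  cyc_notMem : ∀ i, i < L → cyc i ∉ T
  par_mem : ∀ v ∈ T, par v ∈ T ∨ ∃ i, i < L ∧ par v = cyc i
  dep_lt : ∀ v ∈ T, par v ∈ T → dep (par v) < dep v
  supp : ∀ x y : Fin n, x ≠ y → w s(x, y) ≠ 0 →
    (∃ i, i < L ∧ s(x, y) = cycE L cyc i) ∨ (x ∈ T ∧ y = par x) ∨ (y ∈ T ∧ x = par y)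

namespace PForest

variable {L : ℕ} {cyc : ℕ → Fin n} {idx : Fin n → ℕ} {T : Finset (Fin n)} {par : Fin n → Fin n} {dep : Fin n → ℕ}
  {w : Sym2 (Fin n) → unitInterval} (P : PForest L cyc idx T par dep w)
include P

/-- A tree vertex is not its own parent. [this work] -/
theorem par_ne {v : Fin n} (hv : v ∈ T) : par v ≠ v := by
  intro h
  rcases P.par_mem v hv with hp | ⟨i, hi, hpi⟩
  · have := P.dep_lt v hv hp; rw [h] at this; exact lt_irrefl _ this
  · exact P.cyc_notMem i hi (by rw [← hpi, h]; exact hv)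

/-- A tree vertex lies on no cycle pair. [this work] -/
theorem not_mem_cycE {v : Fin n} (hv : v ∈ T) {i : ℕ} (hi : i < L) : v ∉ cycE L cyc i := by
  intro h
  unfold cycE at h
  have hL0 : 0 < L := by have := P.hL; omega
  rcases Sym2.mem_iff.1 h with h1 | h1
  · exact P.cyc_notMem i hi (h1 ▸ hv)
  · exact P.cyc_notMem _ (Nat.mod_lt _ hL0) (h1 ▸ hv)

/-- The positive pairs at a tree vertex `v` go to its parent or to its children. [this work] -/
theorem pair_at {v x : Fin n} (hv : v ∈ T) (hxv : x ≠ v) (hw : w s(v, x) ≠ 0) : x = par v ∨ (x ∈ T ∧ par x = v) := by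
  rcases P.supp v x hxv.symm hw with ⟨i, hi, he⟩ | ⟨-, h⟩ | ⟨hx, h⟩
  · exact absurd (he ▸ Sym2.mem_mk_left v x) (P.not_mem_cycE hv hi)
  · exact Or.inl h
  · exact Or.inr ⟨hx, h.symm⟩

/-- A LEAF (no children) has positive pairs only to its parent. [this work] -/
theorem pendant_of_leaf {v : Fin n} (hv : v ∈ T) (hleaf : ∀ c ∈ T, par c ≠ v) :
    ∀ x : Fin n, x ≠ v → x ≠ par v → w s(v, x) = 0 := by
  intro x hxv hxp
  by_contra hw
  rcases P.pair_at hv hxv hw with h | ⟨hx, h⟩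
  · exact hxp h
  · exact hleaf x hx h

end PForest

/-- A vertex all of whose pairs have weight `0` is joined to nothing: `P(o ↔ c) = 0` for `o ≠ c`. [this work] -/
theorem real_openConn_eq_zero_of_isolated (w : Sym2 (Fin n) → unitInterval) {o c : Fin n} (hoc : o ≠ c)
    (hiso : ∀ x : Fin n, x ≠ c → w s(c, x) = 0) : (prodBernoulli w).real (openConn o c) = 0 := by
  rw [PendantPeeling.measureReal_eq_inter_support w (openConn o c)]
  have : {ω : BondConfig (Fin n) | ω ∩ {e | w e ≠ 0} ∈ openConn o c} = ∅ := by
    ext ω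
    simp only [mem_setOf_eq, Set.mem_empty_iff_false, iff_false]
    intro h
    have h' : (openGraph (ω ∩ {e | w e ≠ 0})).Reachable c o := (h : (openGraph (ω ∩ {e | w e ≠ 0})).Reachable o c).symm
    obtain ⟨q⟩ := h'
    cases q with
    | nil => exact hoc rfl
    | cons hadj q' =>
      rename_i x
      rw [openGraph_adj] at hadj
      exact hadj.1.2 (hiso x (Ne.symm hadj.2))
  rw [this, measureReal_empty]

end Bundle

end Quant

end Summit.CriticalPhenomena.PercolationContinuityZ3.Theorems
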